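import Summits.QuantumFields.YangMills.Theorems.ColdStartUniversalityUniformColdStartMixingRungOfMixing
import Summits.QuantumFields.YangMills.Theorems.ColdStartUniversalityLatticeLangevinMeasurableFlow
import Summits.QuantumFields.YangMills.Theorems.ColdStartUniversalityLatticeLangevinLawUniqueStart
import Literature.Probability.Process.HarrisSemigroup
import Literature.MathematicalPhysics.QuantumFieldTheory.LatticeGaugeProofs
import HarnessLib

/-!
# Route `ColdStartUniversality`, crux K_A1 `UniformColdStartMixing` (stmt-QuantumFields-24809), rung
# `stub_fixedCutoffMixing`: (M) pointwise mixing ⇐ HARRIS' THEOREM for the SZZ transition kernels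

Helper file (seat `ym-line-csu-p1`, g4).  The rung's single open input (M) «the cold-start law of the fixed-cut-off
SU(2) Shen–Zhu–Zhu diffusion converges to the Wilson–Gibbs measure on bounded measurable observables» (file
`…RungOfMixing`) is reduced, KERNEL-CHECKED, to three textbook statements about THE transition kernels
`κ_t(x, ·) = law(U^x_t)` of the dynamics (well defined by `lawUnique_of_start`; realised as Mathlib Markov kernels on
`SU(2)^E` by `exists_transitionKernel`, from the jointly measurable solution family `latticeLangevinMeasurableFlow_su2`):

* (CK) Chapman–Kolmogorov `κ_{s+t} = κ_t ∘ₖ κ_s` — the Markov property of the strong solutions (OPEN here, L);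
* (D) a Doeblin minorisation `κ_{t₀}(z, ·) ≥ ν ≠ 0` for all `z` at one time `t₀` — positivity of the transition
  density of the elliptic diffusion on the compact connected `SU(2)^E` (OPEN here, the analytic content, XL);
* (Inv) invariance of the Wilson measure — the tree's NAMED FACT `WilsonMeasureLangevinInvariant` (SZZ Lemma 3.3),
  converted to Mathlib's `Kernel.Invariant` (`wilson_invariant_of_fact`).

Given these, the tree's continuous-time Harris theorem (`Literature.Probability.Process.MarkovSemigroup.
exp_convergence_of_drift_of_minorization`, Lyapunov function `V ≡ 1` on the compact state space) gives
`|E f(U^z_t) − ∫ f dμ_{β'}| ≤ 2C e^{−ct}` for every start `z` and every measurable `|f| ≤ 1` — in particular (M)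
(`pointwiseMixing_of_harris`) and hence the rung (`fixedCutoffMixing_of_harris`, via `fixedCutoffMixing_of_pointwiseMixing`).

No definition, no sorry.  RECORD-rung R3 plumbing; nothing here bears on the Yang–Mills mass gap.
-/

set_option autoImplicit false

noncomputable section

namespace Summit.QuantumFields.YangMills.Theorems.ColdStartUniversality

open MeasureTheory ProbabilityTheory Filter Topology
open scoped NNReal ENNReal
open Literature.Probability.Process
open Literature.MathematicalPhysics.QuantumFieldTheory
open Literature.MathematicalPhysics.QuantumLattice (fundamentalRep fundamentalLatticeRep continuous_fundamentalRep)
open Literature.MathematicalPhysics.QuantumFieldTheory.Balaban1983to89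

/-! ## The transition kernels of the SU(2) lattice Langevin dynamics -/

/-- **The transition kernels exist as Markov kernels**: there is a family `κ : ℝ≥0 → Kernel SU(2)^E SU(2)^E` of Markov
kernels with `κ 0 = id` REALISING the transition laws of the SZZ dynamics at coupling `β'` — for every solution `U`
from a deterministic start `x` on any probability space with a flat driver, `law(U_t) = κ t x` (the laws of the jointly
measurable solution family on the product Wiener space; independence of the realisation is `lawUnique_of_start`).
[cite: ShenZhuZhu2022, §3 (Markov semigroup P_t^L after Lemma 3.3, p. 13)] -/
theorem exists_transitionKernel (L : ℕ) [NeZero L] (β' : ℝ) :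
    ∃ κ : ℝ≥0 → Kernel (GaugeConfig 3 L (Matrix.specialUnitaryGroup (Fin 2) ℂ))
        (GaugeConfig 3 L (Matrix.specialUnitaryGroup (Fin 2) ℂ)),
      (∀ t, IsMarkovKernel (κ t)) ∧ κ 0 = Kernel.id ∧
      ∀ (t : ℝ≥0) (x : GaugeConfig 3 L (Matrix.specialUnitaryGroup (Fin 2) ℂ))
        (Ω : Type) [MeasurableSpace Ω] (P : Measure Ω) [IsProbabilityMeasure P]
        (W : ℝ≥0 → Ω → (Edge 3 L × NoiseIdx 2 → ℝ)) (hW : IsFlatBrownian W P)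
        (U : ℝ≥0 → Ω → GaugeConfig 3 L (Matrix.specialUnitaryGroup (Fin 2) ℂ)),
        (∀ ω, U 0 ω = x) →
        (latticeLangevinDynamics (fundamentalLatticeRep 2) β').IsSolution (fundamentalRep (Fin 2))
          hW.natFiltration P W U →
        κ t x = P.map (U t) := by
  classical
  haveI := isProbabilityMeasure_piWiener (Edge 3 L × NoiseIdx 2)
  have hWc := isFlatBrownian_piWiener 3 L (NoiseIdx 2)
  obtain ⟨Uc, hUc, hmeas⟩ := latticeLangevinMeasurableFlow_su2 L β'
    (LatticeRep.isClassicalDefining_specialUnitaryGroup 2) _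
    (Measure.pi fun _ : Edge 3 L × NoiseIdx 2 => preWienerMeasure) _ hWc
  have hmU : ∀ x t, Measurable (Uc x t) := fun x t =>
    ((hUc x).2.adapted t).mono (hWc.natFiltration.le t) le_rfl
  have hker : ∀ t : ℝ≥0, Measurable fun x : GaugeConfig 3 L (Matrix.specialUnitaryGroup (Fin 2) ℂ) =>
      (Measure.pi fun _ : Edge 3 L × NoiseIdx 2 => preWienerMeasure).map (Uc x t) := by
    intro t
    refine Measure.measurable_of_measurable_coe _ fun s hs => ?_
    have hfun : (fun x : GaugeConfig 3 L (Matrix.specialUnitaryGroup (Fin 2) ℂ) =>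
        ((Measure.pi fun _ : Edge 3 L × NoiseIdx 2 => preWienerMeasure).map (Uc x t)) s) =
        fun x => (Measure.pi fun _ : Edge 3 L × NoiseIdx 2 => preWienerMeasure)
          (Prod.mk x ⁻¹' ((fun p : GaugeConfig 3 L (Matrix.specialUnitaryGroup (Fin 2) ℂ) ×
            ((Edge 3 L × NoiseIdx 2) → (ℝ≥0 → ℝ)) => Uc p.1 t p.2) ⁻¹' s)) := by
      funext x
      rw [Measure.map_apply (hmU x t) hs]
      rfl
    rw [hfun]
    exact measurable_measure_prodMk_left (hmeas t hs)
  refine ⟨fun t => ⟨fun x => (Measure.pi fun _ : Edge 3 L × NoiseIdx 2 => preWienerMeasure).map (Uc x t), hker t⟩,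
    fun t => ⟨fun x => Measure.isProbabilityMeasure_map (hmU x t).aemeasurable⟩, ?_, ?_⟩
  · ext x s hs
    change ((Measure.pi fun _ : Edge 3 L × NoiseIdx 2 => preWienerMeasure).map (Uc x 0)) s = (Kernel.id x) s
    have h0 : Uc x 0 = fun _ => x := funext fun ω => (hUc x).1 ω
    rw [h0, Measure.map_const, measure_univ, one_smul, Kernel.id_apply]
  · intro t x Ω _ P _ W hW U hU0 hU
    change (Measure.pi fun _ : Edge 3 L × NoiseIdx 2 => preWienerMeasure).map (Uc x t) = P.map (U t)
    exact (lawUnique_of_start β' x hW hWc hU0 hU (fun ω => (hUc x).1 ω) (hUc x).2 t).symm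

/-! ## Doeblin minorisations propagate along a Markov semigroup -/

/-- If `ν ≤ κ y` for every `y`, then `ν ≤ (κ ∘ₖ η) z` for every Markov kernel `η` and every `z`. [folklore] -/
theorem le_comp_apply_of_forall_le {X : Type*} [MeasurableSpace X] {κ η : Kernel X X} [IsMarkovKernel η]
    {ν : Measure X} (h : ∀ y, ν ≤ κ y) (z : X) : ν ≤ (κ ∘ₖ η) z := by
  refine Measure.le_iff.2 fun s hs => ?_
  rw [Kernel.comp_apply' _ _ _ hs]
  calc ν s = ∫⁻ _y, ν s ∂(η z) := by rw [lintegral_const, measure_univ, mul_one]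
    _ ≤ ∫⁻ y, κ y s ∂(η z) := lintegral_mono fun y => Measure.le_iff.1 (h y) s hs

/-! ## Invariance of the Wilson measure, from the named fact, in kernel form -/

/-- **`WilsonMeasureLangevinInvariant` ⇒ `Kernel.Invariant`**: if the Wilson measure is invariant under the transition
operators of the SZZ solution families (the tree's named fact, SZZ Lemma 3.3) then it is invariant under any Markov
kernel family realising the transition laws (apply the fact to the jointly measurable solution family on the product
Wiener space and test on indicators). [cite: ShenZhuZhu2022, §3 Lemma 3.3 (invariance of the lattice Yang–Mills measure; p. 13)] -/
theorem wilson_invariant_of_fact (L : ℕ) [NeZero L] (β' : ℝ)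
    (hWinv : WilsonMeasureLangevinInvariant (fundamentalLatticeRep 2) 3 L β')
    (κ : ℝ≥0 → Kernel (GaugeConfig 3 L (Matrix.specialUnitaryGroup (Fin 2) ℂ))
      (GaugeConfig 3 L (Matrix.specialUnitaryGroup (Fin 2) ℂ))) [∀ t, IsMarkovKernel (κ t)]
    (hreal : ∀ (t : ℝ≥0) (x : GaugeConfig 3 L (Matrix.specialUnitaryGroup (Fin 2) ℂ))
        (Ω : Type) [MeasurableSpace Ω] (P : Measure Ω) [IsProbabilityMeasure P]
        (W : ℝ≥0 → Ω → (Edge 3 L × NoiseIdx 2 → ℝ)) (hW : IsFlatBrownian W P)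
        (U : ℝ≥0 → Ω → GaugeConfig 3 L (Matrix.specialUnitaryGroup (Fin 2) ℂ)),
        (∀ ω, U 0 ω = x) →
        (latticeLangevinDynamics (fundamentalLatticeRep 2) β').IsSolution (fundamentalRep (Fin 2))
          hW.natFiltration P W U →
        κ t x = P.map (U t))
    (t : ℝ≥0) :
    Kernel.Invariant (κ t) (wilsonMeasure (d := 3) (L := L) (fundamentalRep (Fin 2)) β') := by
  classical
  haveI := isProbabilityMeasure_piWiener (Edge 3 L × NoiseIdx 2)
  haveI : IsProbabilityMeasure (wilsonMeasure (d := 3) (L := L) (fundamentalRep (Fin 2)) β') :=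
    isProbabilityMeasure_wilsonMeasure (d := 3) (L := L) (fundamentalRep (Fin 2)) (continuous_fundamentalRep (Fin 2)) β'
  have hWc := isFlatBrownian_piWiener 3 L (NoiseIdx 2)
  obtain ⟨Uc, hUc, -⟩ := latticeLangevinMeasurableFlow_su2 L β'
    (LatticeRep.isClassicalDefining_specialUnitaryGroup 2) _
    (Measure.pi fun _ : Edge 3 L × NoiseIdx 2 => preWienerMeasure) _ hWc
  have hmU : ∀ x s, Measurable (Uc x s) := fun x s =>
    ((hUc x).2.adapted s).mono (hWc.natFiltration.le s) le_rfl
  have hfact := hWinv (LatticeRep.isClassicalDefining_specialUnitaryGroup 2) _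
    (Measure.pi fun _ : Edge 3 L × NoiseIdx 2 => preWienerMeasure) _ hWc Uc hUc
  -- the kernel at `x` charges `A` with the probability that the canonical solution from `x` is in `A`
  have hκA : ∀ (x : GaugeConfig 3 L (Matrix.specialUnitaryGroup (Fin 2) ℂ))
      {A : Set (GaugeConfig 3 L (Matrix.specialUnitaryGroup (Fin 2) ℂ))}, MeasurableSet A →
      κ t x A = (Measure.pi fun _ : Edge 3 L × NoiseIdx 2 => preWienerMeasure) (Uc x t ⁻¹' A) := by
    intro x A hA
    rw [hreal t x _ (Measure.pi fun _ : Edge 3 L × NoiseIdx 2 => preWienerMeasure) _ hWc (Uc x)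
      (hUc x).1 (hUc x).2, Measure.map_apply (hmU x t) hA]
  unfold Kernel.Invariant
  ext A hA
  rw [Measure.bind_apply hA (κ t).measurable.aemeasurable]
  -- the named fact on the indicator of `A`
  have h1 := hfact (A.indicator fun _ => (1 : ℝ)) (measurable_const.indicator hA)
    ⟨1, fun y => by by_cases hy : y ∈ A <;> simp [hy]⟩ t
  have h2 : ∀ x, markovTransition Uc (Measure.pi fun _ : Edge 3 L × NoiseIdx 2 => preWienerMeasure) t
      (A.indicator fun _ => (1 : ℝ)) x = (κ t x A).toReal := by
    intro x
    rw [markovTransition, hκA x hA]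
    have hind : (fun ω => A.indicator (fun _ => (1 : ℝ)) (Uc x t ω)) =
        (Uc x t ⁻¹' A).indicator fun _ => (1 : ℝ) := by
      funext ω
      simp only [Set.indicator, Set.mem_preimage]
    rw [hind, integral_indicator (hmU x t hA), setIntegral_const, smul_eq_mul, mul_one, measureReal_def]
  simp_rw [h2] at h1
  rw [integral_indicator hA, setIntegral_const, smul_eq_mul, mul_one, measureReal_def,
    integral_toReal ((κ t).measurable_coe hA).aemeasurable
      (Eventually.of_forall fun x => (measure_lt_top (κ t x) A))] at h1
  have hne : ∫⁻ x, κ t x A ∂(wilsonMeasure (d := 3) (L := L) (fundamentalRep (Fin 2)) β') ≠ ∞ := by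
    refine ne_top_of_le_ne_top (measure_ne_top (wilsonMeasure (d := 3) (L := L) (fundamentalRep (Fin 2)) β')
      Set.univ) ?_
    calc ∫⁻ x, κ t x A ∂(wilsonMeasure (d := 3) (L := L) (fundamentalRep (Fin 2)) β')
        ≤ ∫⁻ _x, 1 ∂(wilsonMeasure (d := 3) (L := L) (fundamentalRep (Fin 2)) β') :=
          lintegral_mono fun x => prob_le_one
      _ = _ := by rw [lintegral_const, one_mul]
  exact (ENNReal.toReal_eq_toReal_iff' hne (measure_ne_top _ A)).1 h1

/-! ## (M) from Harris' theorem -/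

/-- **(M) pointwise mixing of the cold start ⇐ (CK) ∧ (D) ∧ (Inv)** via the tree's Harris theorem for Markov semigroups
(`MarkovSemigroup.exp_convergence_of_drift_of_minorization` with `V ≡ 1`): for THE transition kernels of the SU(2) SZZ
dynamics (any Markov kernel family realising the transition laws), Chapman–Kolmogorov, a Doeblin minorisation at one
positive time and the named fact `WilsonMeasureLangevinInvariant` give exponentially fast convergence of `law(U^z_t)` to
the Wilson measure on measurable `|f| ≤ 1`, uniformly in the start; in particular (M) for the cold start.
[cite: HairerMattingly2011, Theorems 1.2 and 1.3] [cite: ShenZhuZhu2022, §3 Lemma 3.3 (p. 13)] -/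
theorem pointwiseMixing_of_harris
    (hCK : ∀ (L : ℕ) [NeZero L] (β' : ℝ)
      (κ : ℝ≥0 → Kernel (GaugeConfig 3 L (Matrix.specialUnitaryGroup (Fin 2) ℂ))
        (GaugeConfig 3 L (Matrix.specialUnitaryGroup (Fin 2) ℂ))) [∀ t, IsMarkovKernel (κ t)],
      (∀ (t : ℝ≥0) (x : GaugeConfig 3 L (Matrix.specialUnitaryGroup (Fin 2) ℂ))
          (Ω : Type) [MeasurableSpace Ω] (P : Measure Ω) [IsProbabilityMeasure P]
          (W : ℝ≥0 → Ω → (Edge 3 L × NoiseIdx 2 → ℝ)) (hW : IsFlatBrownian W P)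
          (U : ℝ≥0 → Ω → GaugeConfig 3 L (Matrix.specialUnitaryGroup (Fin 2) ℂ)),
          (∀ ω, U 0 ω = x) →
          (latticeLangevinDynamics (fundamentalLatticeRep 2) β').IsSolution (fundamentalRep (Fin 2))
            hW.natFiltration P W U →
          κ t x = P.map (U t)) →
      ∀ s t : ℝ≥0, κ (s + t) = κ t ∘ₖ κ s)
    (hD : ∀ (L : ℕ) [NeZero L] (β' : ℝ)
      (κ : ℝ≥0 → Kernel (GaugeConfig 3 L (Matrix.specialUnitaryGroup (Fin 2) ℂ))
        (GaugeConfig 3 L (Matrix.specialUnitaryGroup (Fin 2) ℂ))) [∀ t, IsMarkovKernel (κ t)],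
      (∀ (t : ℝ≥0) (x : GaugeConfig 3 L (Matrix.specialUnitaryGroup (Fin 2) ℂ))
          (Ω : Type) [MeasurableSpace Ω] (P : Measure Ω) [IsProbabilityMeasure P]
          (W : ℝ≥0 → Ω → (Edge 3 L × NoiseIdx 2 → ℝ)) (hW : IsFlatBrownian W P)
          (U : ℝ≥0 → Ω → GaugeConfig 3 L (Matrix.specialUnitaryGroup (Fin 2) ℂ)),
          (∀ ω, U 0 ω = x) →
          (latticeLangevinDynamics (fundamentalLatticeRep 2) β').IsSolution (fundamentalRep (Fin 2))
            hW.natFiltration P W U →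
          κ t x = P.map (U t)) →
      ∃ (t₀ : ℝ≥0) (ν : Measure (GaugeConfig 3 L (Matrix.specialUnitaryGroup (Fin 2) ℂ))),
        ν ≠ 0 ∧ ∀ z, ν ≤ κ t₀ z)
    (hWinv : ∀ (L : ℕ) [NeZero L] (β' : ℝ), WilsonMeasureLangevinInvariant (fundamentalLatticeRep 2) 3 L β') :
    ∀ (L : ℕ) [NeZero L] (β' : ℝ)
      (f : GaugeConfig 3 L (Matrix.specialUnitaryGroup (Fin 2) ℂ) → ℝ), Measurable f → (∀ V, |f V| ≤ 1) →
      ∀ δ : ℝ, 0 < δ → ∃ t₀ : ℝ, ∀ t : ℝ, t₀ ≤ t →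
        ∃ (Ω : Type) (_mΩ : MeasurableSpace Ω) (P : Measure Ω) (_hP : IsProbabilityMeasure P)
          (W : ℝ≥0 → Ω → (Edge 3 L × NoiseIdx 2 → ℝ)) (hW : IsFlatBrownian W P)
          (U : ℝ≥0 → Ω → GaugeConfig 3 L (Matrix.specialUnitaryGroup (Fin 2) ℂ)),
          (∀ ω, U 0 ω = fun _ => 1) ∧
          (latticeLangevinDynamics (fundamentalLatticeRep 2) β').IsSolution (fundamentalRep (Fin 2))
            hW.natFiltration P W U ∧
          |(∫ V, f V ∂(wilsonMeasure (d := 3) (L := L) (fundamentalRep (Fin 2)) β')) -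
              ∫ ω, f (U t.toNNReal ω) ∂P| ≤ δ := by
  intro L _ β' f hf hf1 δ hδ
  classical
  haveI := isProbabilityMeasure_piWiener (Edge 3 L × NoiseIdx 2)
  haveI : IsProbabilityMeasure (wilsonMeasure (d := 3) (L := L) (fundamentalRep (Fin 2)) β') :=
    isProbabilityMeasure_wilsonMeasure (d := 3) (L := L) (fundamentalRep (Fin 2)) (continuous_fundamentalRep (Fin 2)) β'
  haveI : Nonempty (GaugeConfig 3 L (Matrix.specialUnitaryGroup (Fin 2) ℂ)) := ⟨fun _ => 1⟩
  -- the transition kernels, Chapman–Kolmogorov, Doeblin, invariance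
  obtain ⟨κ, hκM, hκ0, hreal⟩ := exists_transitionKernel L β'
  haveI : ∀ t, IsMarkovKernel (κ t) := hκM
  have hadd : ∀ s t : ℝ≥0, κ (s + t) = κ t ∘ₖ κ s := hCK L β' κ hreal
  obtain ⟨td, ν, hν0, hν⟩ := hD L β' κ hreal
  have hinv : ∀ t, Kernel.Invariant (κ t) (wilsonMeasure (d := 3) (L := L) (fundamentalRep (Fin 2)) β') :=
    fun t => wilson_invariant_of_fact L β' (hWinv L β') κ hreal t
  -- Harris with the Lyapunov function `V ≡ 1`
  have hminor : ∀ R : ℝ≥0, ∃ t_R : ℝ≥0, ∀ t : ℝ≥0, t_R ≤ t →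
      ∃ ν' : Measure (GaugeConfig 3 L (Matrix.specialUnitaryGroup (Fin 2) ℂ)), ν' ≠ 0 ∧
        ∀ z, (fun _ => (1 : ℝ≥0)) z ≤ R → ν' ≤ κ t z := by
    intro R
    refine ⟨td, fun t ht => ⟨ν, hν0, fun z _ => ?_⟩⟩
    have ht' : κ t = κ td ∘ₖ κ (t - td) := by
      rw [← hadd (t - td) td, tsub_add_cancel_of_le ht]
    rw [ht']
    exact le_comp_apply_of_forall_le hν z
  have hdrift : ∀ z, ∫⁻ y, ((fun _ => (1 : ℝ≥0)) y : ℝ≥0∞) ∂(κ 1 z) ≤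
      ((2⁻¹ : ℝ≥0) : ℝ≥0∞) * (fun _ => (1 : ℝ≥0)) z + ((2⁻¹ : ℝ≥0) : ℝ≥0∞) := by
    intro z
    simp only [ENNReal.coe_one, lintegral_const, measure_univ, mul_one, ENNReal.coe_inv two_ne_zero,
      ENNReal.coe_ofNat, ENNReal.inv_two_add_inv_two, le_refl]
  have hflow : ∀ (s : ℝ≥0) (x : GaugeConfig 3 L (Matrix.specialUnitaryGroup (Fin 2) ℂ)),
      ∫⁻ y, ((fun _ => (1 : ℝ≥0)) y : ℝ≥0∞) ∂(κ s x) ≤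
        ENNReal.ofReal (Real.exp (0 * s)) * (fun _ => (1 : ℝ≥0)) x := by
    intro s x
    simp only [ENNReal.coe_one, lintegral_const, measure_univ, mul_one, zero_mul, Real.exp_zero,
      ENNReal.ofReal_one, le_refl]
  obtain ⟨C, c, hC, hc, hbound⟩ :=
    MarkovSemigroup.exp_convergence_of_drift_of_minorization κ hκ0 hadd (V := fun _ => (1 : ℝ≥0))
      measurable_const (t₁ := 1) one_pos (a := 2⁻¹) (b₀ := 2⁻¹) (by norm_num) hdrift hminor
      (Cstar := 0) le_rfl hflow (wilsonMeasure (d := 3) (L := L) (fundamentalRep (Fin 2)) β') hinv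
  -- choose the time: `2C e^{-ct} ≤ δ` for `t ≥ t₀`
  set A : ℝ := C * (1 + 1) with hA
  have hA0 : 0 < A := by rw [hA]; positivity
  refine ⟨max 0 (Real.log (A / δ) / c), fun t ht => ?_⟩
  have ht0 : 0 ≤ t := le_trans (le_max_left _ _) ht
  have hlog : Real.log (A / δ) ≤ c * t := by
    have h := le_trans (le_max_right _ _) ht
    rw [div_le_iff₀ hc] at h
    linarith [mul_comm t c]
  have hexp : A * Real.exp (-c * t) ≤ δ := by
    have h1 : Real.exp (-c * t) ≤ Real.exp (-Real.log (A / δ)) := Real.exp_le_exp.2 (by linarith)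
    rw [Real.exp_neg, Real.exp_log (div_pos hA0 hδ), inv_div] at h1
    calc A * Real.exp (-c * t) ≤ A * (δ / A) := mul_le_mul_of_nonneg_left h1 hA0.le
      _ = δ := mul_div_cancel₀ δ hA0.ne'
  -- the cold-start solution on the product Wiener space
  have hWc := isFlatBrownian_piWiener 3 L (NoiseIdx 2)
  obtain ⟨U, hU0, hU⟩ := coldStart_solution L β' hWc
  refine ⟨_, inferInstance, _, inferInstance, _, hWc, U, hU0, hU, ?_⟩
  have hmUt : Measurable (U t.toNNReal) := (hU.adapted _).mono (hWc.natFiltration.le _) le_rfl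
  have hlaw := hreal t.toNNReal (fun _ => 1) _ (Measure.pi fun _ : Edge 3 L × NoiseIdx 2 => preWienerMeasure) _
    hWc U hU0 hU
  have hint : ∫ ω, f (U t.toNNReal ω) ∂(Measure.pi fun _ : Edge 3 L × NoiseIdx 2 => preWienerMeasure) =
      ∫ y, f y ∂(κ t.toNNReal (fun _ => 1)) := by
    rw [hlaw, integral_map hmUt.aemeasurable hf.aestronglyMeasurable]
  rw [hint, abs_sub_comm]
  have hb := hbound (fun _ => 1) t.toNNReal f hf (fun y => by simpa using hf1 y)
  have ht' : ((t.toNNReal : ℝ≥0) : ℝ) = t := Real.coe_toNNReal t ht0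
  rw [ht'] at hb
  have hb2 : C * (1 + ((fun _ : GaugeConfig 3 L (Matrix.specialUnitaryGroup (Fin 2) ℂ) => (1 : ℝ≥0))
      (fun _ => 1) : ℝ)) * Real.exp (-c * t) = A * Real.exp (-c * t) := by
    simp only [NNReal.coe_one, hA]
  rw [hb2] at hb
  exact hb.trans hexp

/-- **The rung `stub_fixedCutoffMixing` from (CK) ∧ (D) ∧ the named fact `WilsonMeasureLangevinInvariant`** — composing
`pointwiseMixing_of_harris` with the landed `fixedCutoffMixing_of_pointwiseMixing`. [folklore] -/
theorem fixedCutoffMixing_of_harris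
    (hCK : ∀ (L : ℕ) [NeZero L] (β' : ℝ)
      (κ : ℝ≥0 → Kernel (GaugeConfig 3 L (Matrix.specialUnitaryGroup (Fin 2) ℂ))
        (GaugeConfig 3 L (Matrix.specialUnitaryGroup (Fin 2) ℂ))) [∀ t, IsMarkovKernel (κ t)],
      (∀ (t : ℝ≥0) (x : GaugeConfig 3 L (Matrix.specialUnitaryGroup (Fin 2) ℂ))
          (Ω : Type) [MeasurableSpace Ω] (P : Measure Ω) [IsProbabilityMeasure P]
          (W : ℝ≥0 → Ω → (Edge 3 L × NoiseIdx 2 → ℝ)) (hW : IsFlatBrownian W P)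
          (U : ℝ≥0 → Ω → GaugeConfig 3 L (Matrix.specialUnitaryGroup (Fin 2) ℂ)),
          (∀ ω, U 0 ω = x) →
          (latticeLangevinDynamics (fundamentalLatticeRep 2) β').IsSolution (fundamentalRep (Fin 2))
            hW.natFiltration P W U →
          κ t x = P.map (U t)) →
      ∀ s t : ℝ≥0, κ (s + t) = κ t ∘ₖ κ s)
    (hD : ∀ (L : ℕ) [NeZero L] (β' : ℝ)
      (κ : ℝ≥0 → Kernel (GaugeConfig 3 L (Matrix.specialUnitaryGroup (Fin 2) ℂ))
        (GaugeConfig 3 L (Matrix.specialUnitaryGroup (Fin 2) ℂ))) [∀ t, IsMarkovKernel (κ t)],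
      (∀ (t : ℝ≥0) (x : GaugeConfig 3 L (Matrix.specialUnitaryGroup (Fin 2) ℂ))
          (Ω : Type) [MeasurableSpace Ω] (P : Measure Ω) [IsProbabilityMeasure P]
          (W : ℝ≥0 → Ω → (Edge 3 L × NoiseIdx 2 → ℝ)) (hW : IsFlatBrownian W P)
          (U : ℝ≥0 → Ω → GaugeConfig 3 L (Matrix.specialUnitaryGroup (Fin 2) ℂ)),
          (∀ ω, U 0 ω = x) →
          (latticeLangevinDynamics (fundamentalLatticeRep 2) β').IsSolution (fundamentalRep (Fin 2))
            hW.natFiltration P W U →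
          κ t x = P.map (U t)) →
      ∃ (t₀ : ℝ≥0) (ν : Measure (GaugeConfig 3 L (Matrix.specialUnitaryGroup (Fin 2) ℂ))),
        ν ≠ 0 ∧ ∀ z, ν ≤ κ t₀ z)
    (hWinv : ∀ (L : ℕ) [NeZero L] (β' : ℝ), WilsonMeasureLangevinInvariant (fundamentalLatticeRep 2) 3 L β') :
    ∀ (F : T3ContinuumYM3Torus.T3Family) (γ : ℝ), 0 < γ →
      ∀ (os : List (T3ContinuumYM3Torus.ULoop3 F)) (δ : ℝ), 0 < δ → ∀ K : ℕ, ∃ T : ℝ, 0 < T ∧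
        ∀ (Ω : Type) (mΩ : MeasurableSpace Ω) (P : Measure Ω) (hP : IsProbabilityMeasure P)
          (W : ℝ≥0 → Ω → (Edge 3 ((F.P K).sitesPerDir 0) × NoiseIdx 2 → ℝ)) (hW : IsFlatBrownian W P)
          (U : ℝ≥0 → Ω → GaugeConfig 3 ((F.P K).sitesPerDir 0) (Matrix.specialUnitaryGroup (Fin 2) ℂ)),
          (∀ ω, U 0 ω = fun _ => 1) →
          (latticeLangevinDynamics (fundamentalLatticeRep 2) ((γ * (F.P K).eps)⁻¹ / 2)).IsSolution
            (fundamentalRep (Fin 2)) hW.natFiltration P W U →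
          |(F.scheme (ExpMeanLog.expMeanLogSU : LoopAverage (Matrix.specialUnitaryGroup (Fin 2) ℂ)) γ).expectAt
                K os -
              T⁻¹ * ∫ s in (0 : ℝ)..T, (∫ ω, (os.map fun C => F.avgObs (ExpMeanLog.expMeanLogSU :
                  LoopAverage (Matrix.specialUnitaryGroup (Fin 2) ℂ)) K C
                (fun b : PBond (F.P K) 0 => U (s / (F.P K).eps).toNNReal ω (b.src, b.dir))).prod ∂P)| ≤ δ :=
  fixedCutoffMixing_of_pointwiseMixing (pointwiseMixing_of_harris hCK hD hWinv)

end Summit.QuantumFields.YangMills.Theorems.ColdStartUniversality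

end
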